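import Summits.BirchSwinnertonDyer.BirchSwinnertonDyer.Theses.PrintCf2
import HarnessLib

/-!
# Route PrintCf2 — aside item `InertShuZhaiThirtySixOfFactsPlus` (stmt-BirchSwinnertonDyer-20597) CLOSED

Cell `bsd-print-cf2` (D-0131 (2) PRINT TIER, leaf CornerF @ `p = 2`), prover p3. The aside is the
BY-NAME slice of the inert type on the `ℚ`-isogeny classes of the explicit Shu–Zhai twists of `36a1`:
granted the twin bundle 𝔅_inert⁺ = 𝔅_inert (the eight facts of `InertTwoRankOneOfFacts`, VERBATIM) ∧
Agashe–Ribet–Stein 2006 Thm 2.6 ∧ the Shu–Zhai §5.2 Table row `36a1`, the W-ALL leaf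
`Summit.BirchSwinnertonDyer.WAllCornerFTwoInertShuZhaiThirtySix` holds. Proof: destructure the bundle
and apply p3's leaf closer `wAllCornerFTwoInertShuZhaiThirtySix_of_facts` (p540044), which needs exactly
Cassels (conjunct 3), modularity (2), row C8 = Burungale–Flach (4), Shu–Zhai Thm 1.2 (6) and Thm 1.4 (7),
ARS06 and the Table row. beyond-print: NO. [cite: ShuZhai2021, Thm. 1.2, Thm. 1.4, §5.2 Table row 36a1]
-/

-- single-conjunct summit: `Summit.BirchSwinnertonDyer.BirchSwinnertonDyer.…` repeats the name by design
set_option linter.dupNamespace false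

namespace Summit.BirchSwinnertonDyer.BirchSwinnertonDyer.Theorems

/-- **Item `InertShuZhaiThirtySixOfFactsPlus` (stmt-BirchSwinnertonDyer-20597) holds**: 𝔅_inert⁺ ⟹ the
Shu–Zhai `36a1` leaf of the inert type, by `wAllCornerFTwoInertShuZhaiThirtySix_of_facts`.
[cite: ShuZhai2021, Thm. 1.2, Thm. 1.4 and §5.2 Table row 36a1] [cite: AgasheRibetStein2006, Thm. 2.6]
[cite: BurungaleFlach2024, Cor. 2] [cite: MilneADT2006, Thm. I.7.3] -/
theorem inertShuZhaiThirtySixOfFactsPlus_proof :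
    Summit.BirchSwinnertonDyer.BirchSwinnertonDyer.Theses.PrintCf2.InertShuZhaiThirtySixOfFactsPlus := by
  unfold Summit.BirchSwinnertonDyer.BirchSwinnertonDyer.Theses.PrintCf2.InertShuZhaiThirtySixOfFactsPlus
  rintro ⟨⟨_, hmod, hCas, hCM, _, h12, h14, _⟩, hARS, htab⟩
  exact Summit.BirchSwinnertonDyer.wAllCornerFTwoInertShuZhaiThirtySix_of_facts hCas h12 h14 hCM hmod hARS
    htab

end Summit.BirchSwinnertonDyer.BirchSwinnertonDyer.Theorems
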